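import Summits.ResolutionOfSingularities.ResolutionOfSingularities.Theorems.PurelyInseparableDim4LoopERegion
import HarnessLib

/-!
# Δ(4 vs 3) for component hopping ‖ K: the COMPONENT-KEYED rule classes are already defeated in scope by a
# branch living in THREE variables (cell `res-dim4-pi`, seat res-dim4-p-8 g2; corollaries of LOOP-E′ p664169)

[OURS · counted 0 · statements about OUR coordinate-centre frame (`Edge`/`StepRule`, `InCoordinateScope`,
`ComponentThreads.IsComponent`) over `𝔽₃` at `(p,q) = (3,3)`; nothing here proves or refutes
`TerminatesInScope 3 3` (∃-rule form) or resolution of singularities in dimension `≥ 4` / characteristic `p`.]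

LOOP-E′ (`LoopC.gR`, `…LoopERegion` §3–§4) is a closed in-scope region of the GLOBAL game whose four
polynomials `gL0 … gL3` involve only `x₁, x₃, x₄`, and at each of its states the coordinate `3`-fold locus
has EXACTLY ONE component (`LoopC.g_lone`).  Consequently EVERY rule keyed to the component structure —
«blow up SOME component whenever one exists» (`R_OD`, cardinality-first / any tie-break, Hironaka's
max-dimensional-component choice of LOOP-C's class, crit-1's lone-component class, …) — is forced onto that
component there and inherits B's hop replies.  This file books the two readings the Δ(4 vs 3) board asks for:

* `gR_xTwoFree` — every state of LOOP-E′ is `x₂`-free (no monomial involves `x₂`), kernel-checked on the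
  term lists;
* **`exists_threeVar_inScope_branch_of_componentRule`** — every `𝔽₃` coordinate rule that picks a component
  of the coordinate `3`-fold locus whenever one exists has an infinite IN-SCOPE `StepRule` branch all of whose
  states are `x₂`-free (inside LOOP-E′);
* **`exists_threeVar_inScope_branch_of_maxDimRule`** — the same for LOOP-C's class (rules picking a
  MAXIMAL-DIMENSIONAL component whenever one exists; the hypothesis of `LoopC.exists_inScope_branch_of_maxDimRule`):
  the max-dimensional-component negative of WORD #45 (3) needs NO fourth variable.
So within the located specimen classes of this cell, component hopping is a `(3,1)`-shaped phenomenon embedded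
in four variables; the fourth variable is idle.  (What IS specific to four variables in the cell so far remains the
N-CF∀ row of `…SpineCertCF3`, a bounded census.)
bears_on: LADDER-RESOLUTION:D157-DOOR2 (res-dim4-pi · Δ(4 vs 3) · F4-C-glob(3,3) rule classes).
Supports stmt-ResolutionOfSingularities-16155 (helper).
-/

set_option linter.dupNamespace false -- mandated namespace of this single-conjunct summit

noncomputable section

open MvPolynomial Finset

namespace Summit.ResolutionOfSingularities.ResolutionOfSingularities.Theorems.PIDim4

namespace LoopC

open StepKit ComponentThreads
open Literature.AlgebraicGeometry.Resolution

/-! ## §1 LOOP-E′ lives in three variables -/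

/-- A term list none of whose exponents involves `x₂` presents an `x₂`-free polynomial. [folklore] -/
theorem xTwoFree_of_all {K : Type} [Field K] [DecidableEq K] {L : Terms 4 K}
    (h : (L.all fun t => decide (t.1 1 = 0)) = true) : ∀ e ∈ (evalT L).support, e 1 = 0 := by
  intro e he
  have hlive := (mem_support_evalT_iff L e).mp he
  simp only [live, List.mem_filter, List.mem_map] at hlive
  obtain ⟨⟨t, ht, hte⟩, -⟩ := hlive
  simp only [List.all_eq_true, decide_eq_true_eq] at h
  have := h t ht
  rw [hte] at this
  exact this

/-- **Every state of LOOP-E′ is `x₂`-free.** [OURS · ‖ K] -/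
theorem gR_xTwoFree : ∀ s ∈ trapSet gR, ∀ e ∈ s.F.support, e 1 = 0 := by
  rintro s ⟨sw, hsw, rfl⟩
  simp only [gR, List.mem_cons, List.not_mem_nil, or_false] at hsw
  rcases hsw with rfl | rfl | rfl | rfl | rfl
  · exact xTwoFree_of_all (L := gL0) (by decide)
  · exact xTwoFree_of_all (L := gL1) (by decide)
  · exact xTwoFree_of_all (L := gL2) (by decide)
  · exact xTwoFree_of_all (L := gL3) (by decide)
  · exact xTwoFree_of_all (L := gL0) (by decide)

/-! ## §2 Component-keyed rules lose in three variables -/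

/-- **Every COMPONENT-PICKING rule has an `x₂`-free infinite in-scope branch** (GLOBAL game, over `𝔽₃`,
`(3,3)`): if `R s` is a component of the coordinate `3`-fold locus whenever some component exists, then from
LOOP-E′'s `t1′` the rule is forced onto the unique component and B hops for ever. [OURS · ‖ K] -/
theorem exists_threeVar_inScope_branch_of_componentRule (R : CentreRule (ZMod 3))
    (hR : ∀ s : State (ZMod 3), (∃ S, IsComponent 3 S s.F) → IsComponent 3 (R s) s.F) :
    ∃ c : ℕ → State (ZMod 3), (∀ k, ∀ e ∈ (c k).F.support, e 1 = 0) ∧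
      ∀ k, InCoordinateScope 3 (c k).F ∧ StepRule 3 R (c k) (c (k + 1)) := by
  obtain ⟨c, hmem, hc⟩ := exists_inScope_branch_of_loneComponentRule' R fun s S hS huniq =>
    huniq (R s) (hR s ⟨S, hS⟩)
  exact ⟨c, fun k => gR_xTwoFree (c k) (hmem k), hc⟩

/-- **LOOP-C's class needs no fourth variable**: every rule picking a MAXIMAL-DIMENSIONAL component whenever
one exists (the hypothesis of `LoopC.exists_inScope_branch_of_maxDimRule`) has an `x₂`-free infinite in-scope
branch over `𝔽₃` at `(3,3)`. [OURS · ‖ K] -/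
theorem exists_threeVar_inScope_branch_of_maxDimRule (R : CentreRule (ZMod 3))
    (hR : ∀ s : State (ZMod 3),
      (∃ S, IsComponent 3 S s.F ∧ ∀ S', IsComponent 3 S' s.F → S.card ≤ S'.card) →
        IsComponent 3 (R s) s.F ∧ ∀ S', IsComponent 3 S' s.F → (R s).card ≤ S'.card) :
    ∃ c : ℕ → State (ZMod 3), (∀ k, ∀ e ∈ (c k).F.support, e 1 = 0) ∧
      ∀ k, InCoordinateScope 3 (c k).F ∧ StepRule 3 R (c k) (c (k + 1)) := by
  obtain ⟨c, hmem, hc⟩ := exists_inScope_branch_of_loneComponentRule' R fun s S hS huniq => by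
    have hmax : IsComponent 3 S s.F ∧ ∀ S', IsComponent 3 S' s.F → S.card ≤ S'.card :=
      ⟨hS, fun S' hS' => (huniq S' hS').symm ▸ le_rfl⟩
    exact huniq (R s) (hR s ⟨S, hmax⟩).1
  exact ⟨c, fun k => gR_xTwoFree (c k) (hmem k), hc⟩

/-- Hence no component-picking rule terminates over `𝔽₃` at `(3,3)` (`TerminatesUnder`), already inside the
`x₂`-free slice. [OURS · ‖ K] -/
theorem not_terminatesUnder_of_componentRule (R : CentreRule (ZMod 3))
    (hR : ∀ s : State (ZMod 3), (∃ S, IsComponent 3 S s.F) → IsComponent 3 (R s) s.F) :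
    ¬ TerminatesUnder 3 R := by
  intro hterm
  obtain ⟨c, -, hc⟩ := exists_threeVar_inScope_branch_of_componentRule R hR
  exact hterm ⟨c, fun k => (hc k).2⟩

end LoopC

end Summit.ResolutionOfSingularities.ResolutionOfSingularities.Theorems.PIDim4

end
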